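import Summits.AnomalousDissipation.AnomalousDissipation.Theses.MarginalStabilityChain
import Literature.Analysis.FunctionSpaces.TorusPlanarLift
import Literature.Analysis.FunctionSpaces.TorusAxisAverage

/-!
# Sketch — crux-ideate `ChainRealisation` (stmt-AnomalousDissipation-14249), round 1, ideator 2

First lemmas of the two idea cards filed from this folder (typed over existing declarations; this file
must elaborate, proofs are not required at the ideate stage):

* §1 `AnnulusLogEnergy` — card `three-clocks-fat-core-ladder`: the circulation ⇒ log-energy inequality on plane
  annuli (Cauchy–Schwarz on circles), the rigorous half of the single-level log ceiling
  `ε_tubes ≤ γ E / (2 log(s/2δ_B))` that forces the realisation to be a ladder.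
* §2 `AxialMomentumTestIdentity` — card `separatrix-flux-pinning`: the PRESSURE-FREE tested balance of the
  axial (`e₂`) momentum against `x₂`-independent tests `ψ ∘ planarProj` for classical solutions on `T³`.
* §3 `PinnedSeparatrixFlux` — card `separatrix-flux-pinning`: the stationary consequence — across level sets of
  any first integral `Ψ` of the mean planar flow the advective flux vanishes identically, so the eddy flux of
  axial momentum is pinned by the enclosed source (Rhines–Young integral constraint, with source, for momentum).
  PROVED (`pinnedSeparatrixFlux_holds`), together with its pointwise-bound corollary `EddyEnergyOnStreamline`
  (`eddyEnergyOnStreamline_holds`) — §3b.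
* §4 `chainRealisation_of_chainThesis` — bookkeeping: every line for this crux may conclude `ChainThesis`.

`lean check`: rc 0, 0 sorries, no warnings (2026-08-16).
-/

noncomputable section

set_option linter.dupNamespace false

open MeasureTheory Set Filter Topology
open scoped InnerProductSpace
open Literature.Analysis.FunctionSpaces Literature.Analysis.FunctionSpaces.Torus
open Literature.Analysis.FluidPDE

namespace Summit.AnomalousDissipation.AnomalousDissipation.Cruxes.ChainRealisation.SketchIdeator2

/-- Local notation: the torus `T³`. -/
local notation "𝕋³" => UnitAddTorus (Fin 3)
/-- Local notation: velocity values. -/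
local notation "E³" => EuclideanSpace ℝ (Fin 3)
/-- Local notation: the planar torus `T²`. -/
local notation "𝕋²" => UnitAddTorus (Fin 2)
/-- Local notation: planar velocity values. -/
local notation "E²" => EuclideanSpace ℝ (Fin 2)

/-! ## §1 Circulation forces logarithmic energy (card `three-clocks-fat-core-ladder`) -/

/-- **Annulus log-energy inequality** (polar form). If a continuous planar field `(u₁,u₂)` has the same
circulation `Γ` around every circle `|x| = r`, `δ ≤ r ≤ R` (e.g. all vorticity of the disc `|x| < R` sits in
the core `|x| < δ`), then its kinetic energy in the annulus is at least `Γ²/(4π)·log(R/δ)`: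
`∫_δ^R r ∫₀^{2π} |u(r,θ)|² dθ dr ≥ Γ²/(2π) log(R/δ)` (Cauchy–Schwarz on each circle:
`Γ² ≤ 2π r² ∫₀^{2π} u_θ² dθ`). The Cartesian annulus integral equals the left side by `polarCoord`.
Consequence used by the card: a row of stretched vortices of circulation `Γ = ΔU s`, spacing `s`, Burgers core
`δ_B = (ν/γ)^{1/2}` carries energy `≥ ΔU² s log(s/2δ_B)/(4π)` per unit sheet area while dissipating
`γΔU²s/(8π)`, i.e. `ε_row ≤ γ E_row / (2 log(s/2δ_B))` — the single-level log ceiling. [folklore] -/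
def AnnulusLogEnergy : Prop :=
  ∀ (u₁ u₂ : ℝ → ℝ → ℝ) (δ R Γ : ℝ),
    Continuous (fun q : ℝ × ℝ => (u₁ q.1 q.2, u₂ q.1 q.2)) → 0 < δ → δ ≤ R →
    (∀ r ∈ Icc δ R,
      ∫ θ in (0 : ℝ)..(2 * Real.pi),
        r * (-Real.sin θ * u₁ (r * Real.cos θ) (r * Real.sin θ) +
              Real.cos θ * u₂ (r * Real.cos θ) (r * Real.sin θ)) = Γ) →
    Γ ^ 2 / (2 * Real.pi) * Real.log (R / δ) ≤
      ∫ r in δ..R, r * ∫ θ in (0 : ℝ)..(2 * Real.pi),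
        (u₁ (r * Real.cos θ) (r * Real.sin θ) ^ 2 + u₂ (r * Real.cos θ) (r * Real.sin θ) ^ 2)

/-- The one-circle step of `AnnulusLogEnergy`: `Γ² ≤ 2π r² ∫₀^{2π} |u|² dθ` (Cauchy–Schwarz in `L²(0,2π)`,
`|(-sin θ, cos θ)·u| ≤ |u|`). [folklore] -/
def CircleCirculationCauchySchwarz : Prop :=
  ∀ (u₁ u₂ : ℝ → ℝ → ℝ) (r Γ : ℝ),
    Continuous (fun q : ℝ × ℝ => (u₁ q.1 q.2, u₂ q.1 q.2)) → 0 < r →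
    (∫ θ in (0 : ℝ)..(2 * Real.pi),
        r * (-Real.sin θ * u₁ (r * Real.cos θ) (r * Real.sin θ) +
              Real.cos θ * u₂ (r * Real.cos θ) (r * Real.sin θ)) = Γ) →
    Γ ^ 2 ≤ 2 * Real.pi * r ^ 2 * ∫ θ in (0 : ℝ)..(2 * Real.pi),
        (u₁ (r * Real.cos θ) (r * Real.sin θ) ^ 2 + u₂ (r * Real.cos θ) (r * Real.sin θ) ^ 2)

/-! ## §2 Pressure-free axial momentum balance (card `separatrix-flux-pinning`) -/

/-- **Axial momentum tested against `x₂`-independent functions is pressure-free.** For a classical solution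
of NS on a convex time set `S` and a smooth planar test `ψ : T² → ℝ` lifted to `φ = ψ ∘ planarProj`
(so `∂₂φ = 0`): `d/dt ∫ φ u₂ = ∫ u₂ (u₀∂₀φ + u₁∂₁φ) + ν ∫ u₂ Δφ + ∫ φ f₂` — the pressure term
`∫ φ ∂₂p = -∫ p ∂₂φ` vanishes and the convective term is `-∫ φ div(u₂u) = ∫ u₂ u·∇φ` with `u·∇φ = u_h·∇_hφ`.
Size M, provable now from `IsClassicalNSSolutionOn.momentum`, `integral_partialDeriv_eq_zero`,
`partialDeriv_comp_planarProj_last`, differentiation under `∫` as in `energy_balance`. [folklore] -/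
def AxialMomentumTestIdentity : Prop :=
  ∀ {S : Set ℝ} {ν : ℝ} {f u : ℝ → 𝕋³ → E³} {p : ℝ → 𝕋³ → ℝ}
    (_h : IsClassicalNSSolutionOn S ν f u p) (_hS : Convex ℝ S) (ψ : 𝕋² → ℝ) (_hψ : IsSmooth ψ)
    {t : ℝ} (_ht : t ∈ S),
    HasDerivWithinAt (fun s => ∫ x, ψ (planarProj x) * u s x 2)
      ((∫ x, u t x 2 *
          ∑ j : Fin 2, u t x (Fin.castSucc j) * partialDeriv (Fin.castSucc j) (ψ ∘ planarProj) x) +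
        ν * (∫ x, u t x 2 * laplacian (ψ ∘ planarProj) x) +
        ∫ x, ψ (planarProj x) * f t x 2)
      S t

/-- Integrated form over `[0,T] ⊆ S` (the shape that is averaged in time: boundary terms are `O(1)` for a
trajectory of bounded energy, so Cesàro means of the right side vanish as `T → ∞`). [folklore] -/
def AxialMomentumIntegratedIdentity : Prop :=
  ∀ {S : Set ℝ} {ν : ℝ} {f u : ℝ → 𝕋³ → E³} {p : ℝ → 𝕋³ → ℝ}
    (_h : IsClassicalNSSolutionOn S ν f u p) (_hS : Convex ℝ S) (ψ : 𝕋² → ℝ) (_hψ : IsSmooth ψ)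
    {T : ℝ} (_hT : 0 ≤ T) (_hST : Icc 0 T ⊆ S),
    (∫ x, ψ (planarProj x) * u T x 2) - ∫ x, ψ (planarProj x) * u 0 x 2 =
      ∫ t in (0 : ℝ)..T,
        ((∫ x, u t x 2 *
            ∑ j : Fin 2, u t x (Fin.castSucc j) * partialDeriv (Fin.castSucc j) (ψ ∘ planarProj) x) +
          ν * (∫ x, u t x 2 * laplacian (ψ ∘ planarProj) x) +
          ∫ x, ψ (planarProj x) * f t x 2)

/-! ## §3 Pinned eddy flux across mean streamlines (card `separatrix-flux-pinning`) -/

/-- **Rhines–Young constraint with source, for axial momentum.** Stationary mean objects on `T²`: mean axial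
velocity `W`, mean planar velocity `V = ∇⊥Ψ` (zero planar momentum), total eddy flux `T` of axial momentum,
axial source `h`, satisfying the weak stationary balance
`∫ (W V + T)·∇ψ + ν W Δψ + h ψ = 0` for all smooth `ψ` (the long-time average of `AxialMomentumTestIdentity`).
Then for every smooth `G : ℝ → ℝ` the ADVECTIVE flux across the level sets of `Ψ` drops out (`V·∇Ψ = 0`
pointwise) and the eddy flux is pinned by the enclosed source:
`∫ G'(Ψ) T·∇Ψ = -∫ h·G(Ψ) - ν ∫ W Δ(G∘Ψ)`; with `G` a smoothed indicator of `(-∞, c]` this reads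
`∮_{Ψ=c} T·n = ∫_{Ψ<c} h + O(ν√E)`. Stated for smooth representatives (the averaged objects are `L²`/measures;
the identity is linear and passes to them). Size S–M, provable now (chain rule for `gradient (G ∘ Ψ)`,
`⟪∇⊥Ψ, ∇Ψ⟫ = 0`). [cite: RhinesYoung1982, §2] -/
def PinnedSeparatrixFlux : Prop :=
  ∀ (ν : ℝ) (h W Ψ : 𝕋² → ℝ) (V T : 𝕋² → E²),
    IsSmooth h → IsSmooth W → IsSmooth Ψ → IsSmooth V → IsSmooth T →
    (∀ x, V x 0 = partialDeriv 1 Ψ x ∧ V x 1 = -partialDeriv 0 Ψ x) →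
    (∀ ψ : 𝕋² → ℝ, IsSmooth ψ →
      ∫ x, (W x * ⟪V x, gradient ψ x⟫_ℝ + ⟪T x, gradient ψ x⟫_ℝ + ν * (W x * laplacian ψ x) +
        h x * ψ x) = 0) →
    ∀ G : ℝ → ℝ, ContDiff ℝ (⊤ : ℕ∞) G →
      ∫ x, deriv G (Ψ x) * ⟪T x, gradient Ψ x⟫_ℝ =
        -(∫ x, h x * G (Ψ x)) - ν * ∫ x, W x * laplacian (G ∘ Ψ) x

/-- **Eddy-energy floor on a mean streamline (the sting, coarea form left informal).** From
`PinnedSeparatrixFlux` and `|T| ≤ k` pointwise (`k` = mean eddy kinetic energy density,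
`T = ⟨u₂'u_h'⟩`): for `G' ≥ 0` supported in `[c, c+η]`, `∫ G'(Ψ) k |∇Ψ| ≥ |∫ h G(Ψ)| - ν√(2E)‖Δ(G∘Ψ)‖₂`,
i.e. `∮_{Ψ=c} k dl ≥ |∫_{Ψ<c} h| - o(1)`: eddies of a bounded regime must carry `O(1)` kinetic energy ON every
closed mean streamline that encloses net axial forcing, uniformly in `ν`. Typed pointwise-bound version. [folklore] -/
def EddyEnergyOnStreamline : Prop :=
  ∀ (ν : ℝ) (h W Ψ k : 𝕋² → ℝ) (V T : 𝕋² → E²) (G : ℝ → ℝ),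
    IsSmooth h → IsSmooth W → IsSmooth Ψ → IsSmooth V → IsSmooth T → Continuous k →
    ContDiff ℝ (⊤ : ℕ∞) G → (∀ s, 0 ≤ deriv G s) → (∀ x, ‖T x‖ ≤ k x) →
    (∀ x, V x 0 = partialDeriv 1 Ψ x ∧ V x 1 = -partialDeriv 0 Ψ x) →
    (∀ ψ : 𝕋² → ℝ, IsSmooth ψ →
      ∫ x, (W x * ⟪V x, gradient ψ x⟫_ℝ + ⟪T x, gradient ψ x⟫_ℝ + ν * (W x * laplacian ψ x) +
        h x * ψ x) = 0) →
    |∫ x, h x * G (Ψ x)| ≤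
      (∫ x, deriv G (Ψ x) * k x * ‖gradient Ψ x‖) + |ν| * |∫ x, W x * laplacian (G ∘ Ψ) x|

/-! ### §3b Proofs of the §3 identities (provable-now claims discharged) -/

/-- Chain rule for the torus gradient against a vector: `⟪w, ∇(G∘Ψ)(x)⟫ = G'(Ψ x)·⟪w, ∇Ψ(x)⟫`. [folklore] -/
theorem inner_gradient_comp_apply {G : ℝ → ℝ} {Ψ : 𝕋² → ℝ} (hG : ContDiff ℝ (⊤ : ℕ∞) G)
    (hΨ : IsSmooth Ψ) (x : 𝕋²) (w : E²) :
    ⟪w, gradient (G ∘ Ψ) x⟫_ℝ = deriv G (Ψ x) * ⟪w, gradient Ψ x⟫_ℝ := by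
  rw [real_inner_comm (gradient (G ∘ Ψ) x) w, real_inner_comm (gradient Ψ x) w,
    Torus.inner_gradient_left, Torus.inner_gradient_left]
  have hd : HasFDerivAt (liftAt Ψ x) (Torus.fderiv Ψ x) 0 :=
    (((hΨ.liftAt x).differentiable (by simp)).differentiableAt).hasFDerivAt
  have hGd : HasDerivAt G (deriv G (liftAt Ψ x 0)) (liftAt Ψ x 0) :=
    ((hG.differentiable (by simp)).differentiableAt).hasDerivAt
  have hcomp : HasFDerivAt (G ∘ liftAt Ψ x) (deriv G (liftAt Ψ x 0) • Torus.fderiv Ψ x) 0 :=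
    hGd.comp_hasFDerivAt 0 hd
  have hlift : liftAt (G ∘ Ψ) x = G ∘ liftAt Ψ x := rfl
  have hfd : Torus.fderiv (G ∘ Ψ) x = deriv G (Ψ x) • Torus.fderiv Ψ x := by
    rw [Torus.fderiv, hlift, hcomp.fderiv, liftAt_apply_zero]
  rw [hfd]
  rfl

/-- `⟪∇⊥Ψ, ∇Ψ⟫ = 0`: a planar field with stream function `Ψ` is tangent to the level sets of `Ψ`. [folklore] -/
theorem inner_perpGrad_gradient_eq_zero {Ψ : 𝕋² → ℝ} {V : 𝕋² → E²} (hΨ : IsSmooth Ψ)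
    (hV : ∀ x, V x 0 = partialDeriv 1 Ψ x ∧ V x 1 = -partialDeriv 0 Ψ x) (x : 𝕋²) :
    ⟪V x, gradient Ψ x⟫_ℝ = 0 := by
  rw [← real_inner_comm (V x) (gradient Ψ x), Torus.inner_gradient_left,
    fderiv_apply_eq_sum_partialDeriv (hΨ.isContDiff (by simp)) x (V x), Fin.sum_univ_two,
    (hV x).1, (hV x).2]
  simp only [smul_eq_mul, Fin.isValue]
  ring

/-- `G ∘ Ψ` is smooth on the torus for smooth `G`, `Ψ`. [folklore] -/
theorem isSmooth_comp {G : ℝ → ℝ} {Ψ : 𝕋² → ℝ} (hG : ContDiff ℝ (⊤ : ℕ∞) G) (hΨ : IsSmooth Ψ) :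
    IsSmooth (G ∘ Ψ) := by
  change ContDiff ℝ _ (lift (G ∘ Ψ))
  have : lift (G ∘ Ψ) = G ∘ lift Ψ := rfl
  rw [this]
  exact hG.comp hΨ

/-- **`PinnedSeparatrixFlux` holds** (Sketch §3): test the stationary balance with `G ∘ Ψ`; the advective
term vanishes by `inner_perpGrad_gradient_eq_zero`, the eddy term becomes `G'(Ψ)⟪T, ∇Ψ⟫` by
`inner_gradient_comp_apply`. [folklore] -/
theorem pinnedSeparatrixFlux_holds : PinnedSeparatrixFlux := by
  intro ν h W Ψ V T hh hW hΨ hV hT hVΨ hbal G hG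
  have hGΨ : IsSmooth (G ∘ Ψ) := isSmooth_comp hG hΨ
  have hb := hbal (G ∘ Ψ) hGΨ
  -- rewrite the integrand pointwise
  have hpt : ∀ x, W x * ⟪V x, gradient (G ∘ Ψ) x⟫_ℝ + ⟪T x, gradient (G ∘ Ψ) x⟫_ℝ +
      ν * (W x * laplacian (G ∘ Ψ) x) + h x * (G ∘ Ψ) x =
      deriv G (Ψ x) * ⟪T x, gradient Ψ x⟫_ℝ + (ν * (W x * laplacian (G ∘ Ψ) x) + h x * G (Ψ x)) := by
    intro x
    rw [inner_gradient_comp_apply hG hΨ x (V x), inner_perpGrad_gradient_eq_zero hΨ hVΨ x,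
      inner_gradient_comp_apply hG hΨ x (T x)]
    simp only [Function.comp_apply, mul_zero]
    ring
  simp_rw [hpt] at hb
  -- integrability of the pieces (all smooth on the compact torus)
  have hG' : ContDiff ℝ (⊤ : ℕ∞) (deriv G) := (contDiff_infty_iff_deriv.mp hG).2
  have hGc : IsSmooth (fun x => deriv G (Ψ x)) := isSmooth_comp (G := deriv G) hG' hΨ
  have h1 : Integrable (fun x => deriv G (Ψ x) * ⟪T x, gradient Ψ x⟫_ℝ) volume :=
    (hGc.smul' (hT.inner hΨ.gradient)).integrable
  have h2 : Integrable (fun x => ν * (W x * laplacian (G ∘ Ψ) x)) volume :=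
    ((hW.smul' hGΨ.laplacian).integrable).const_mul ν
  have h3 : Integrable (fun x => h x * G (Ψ x)) volume :=
    (hh.smul' (isSmooth_comp hG hΨ)).integrable
  have h23 : Integrable (fun x => ν * (W x * laplacian (G ∘ Ψ) x) + h x * G (Ψ x)) volume :=
    h2.add h3
  rw [integral_add h1 h23, integral_add h2 h3, integral_const_mul] at hb
  linarith

/-- **`EddyEnergyOnStreamline` holds** (Sketch §3, the pointwise-bound corollary): from
`pinnedSeparatrixFlux_holds`, `|⟪T, ∇Ψ⟫| ≤ ‖T‖‖∇Ψ‖ ≤ k‖∇Ψ‖` and `G' ≥ 0`. [folklore] -/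
theorem eddyEnergyOnStreamline_holds : EddyEnergyOnStreamline := by
  intro ν h W Ψ k V T G hh hW hΨ hV hT hk hG hG' hTk hVΨ hbal
  have hpin := pinnedSeparatrixFlux_holds ν h W Ψ V T hh hW hΨ hV hT hVΨ hbal G hG
  have hG1 : ContDiff ℝ (⊤ : ℕ∞) (deriv G) := (contDiff_infty_iff_deriv.mp hG).2
  have hGc : IsSmooth (fun x => deriv G (Ψ x)) := isSmooth_comp (G := deriv G) hG1 hΨ
  have h1 : Integrable (fun x => deriv G (Ψ x) * ⟪T x, gradient Ψ x⟫_ℝ) volume :=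
    (hGc.smul' (hT.inner hΨ.gradient)).integrable
  have hbd : Integrable (fun x => deriv G (Ψ x) * k x * ‖gradient Ψ x‖) volume :=
    ((hGc.continuous.mul hk).mul hΨ.gradient.continuous.norm).integrable_unitAddTorus
  have hA : |∫ x, deriv G (Ψ x) * ⟪T x, gradient Ψ x⟫_ℝ| ≤
      ∫ x, deriv G (Ψ x) * k x * ‖gradient Ψ x‖ := by
    refine abs_integral_le_integral_abs.trans (integral_mono h1.abs hbd fun x => ?_)
    rw [abs_mul, abs_of_nonneg (hG' (Ψ x)), mul_assoc]
    refine mul_le_mul_of_nonneg_left ?_ (hG' (Ψ x))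
    exact (abs_real_inner_le_norm (T x) (gradient Ψ x)).trans
      (mul_le_mul_of_nonneg_right (hTk x) (norm_nonneg _))
  have heq : ∫ x, h x * G (Ψ x) =
      -(∫ x, deriv G (Ψ x) * ⟪T x, gradient Ψ x⟫_ℝ) - ν * ∫ x, W x * laplacian (G ∘ Ψ) x := by
    linarith
  rw [heq]
  calc |-(∫ x, deriv G (Ψ x) * ⟪T x, gradient Ψ x⟫_ℝ) - ν * ∫ x, W x * laplacian (G ∘ Ψ) x|
      ≤ |-(∫ x, deriv G (Ψ x) * ⟪T x, gradient Ψ x⟫_ℝ)| + |ν * ∫ x, W x * laplacian (G ∘ Ψ) x| :=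
        abs_sub _ _
    _ = |∫ x, deriv G (Ψ x) * ⟪T x, gradient Ψ x⟫_ℝ| + |ν| * |∫ x, W x * laplacian (G ∘ Ψ) x| := by
        rw [abs_neg, abs_mul]
    _ ≤ (∫ x, deriv G (Ψ x) * k x * ‖gradient Ψ x‖) + |ν| * |∫ x, W x * laplacian (G ∘ Ψ) x| := by
        gcongr

/-! ## §4 Bookkeeping: the crux is concluded by `ChainThesis` -/

open Summit.AnomalousDissipation.AnomalousDissipation.Theses.MarginalStabilityChain in
/-- Every line for `ChainRealisation` may end in `ChainThesis` (the unit-cell antecedents are then unused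
formally; cf. the crux-attack note RESTATES-TARGET). [folklore] -/
theorem chainRealisation_of_chainThesis : ChainThesis → ChainRealisation := fun hX _ _ _ => hX

end Summit.AnomalousDissipation.AnomalousDissipation.Cruxes.ChainRealisation.SketchIdeator2

end
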